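import Summits.QuantumAdvantage.QuantumAdvantage.Theorems.CharDialIslandDialB
import Summits.QuantumAdvantage.QuantumAdvantage.Theorems.CharDialExchangeClasses

/-!
# CharDialIslandDialC — TREE PART C of the decomp-qadv lens-5 g28 node «IslandDial» (REV1 insertion): the ARCHIPELAGO READING of piece I,
# `PropagateAt p` and `islandAt_iff_propagateAt : IslandAt p ↔ PropagateAt p` (⟸ via the tree's `SubChar.law_of_exchange_partners`,
# ⟹ by coefficient-class counting with `exch_of_normalForm` of part B).  Verbatim `section Propagate` of the node file (namespace `Theorems.IslandDial`).
-/

set_option autoImplicit false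
set_option linter.dupNamespace false

namespace Summit.QuantumAdvantage.QuantumAdvantage.Theorems.IslandDial

open Finset
open Summit.QuantumAdvantage.AdviceFreeQNC0
open Literature.Computability.MetaComplexity Literature.Computability.MetaComplexity.Smolensky

/-! ### A second EQUIV reading of piece I: ONE ISLAND ⟹ ARCHIPELAGO (the tree's L2G end `law_of_exchange_partners`) -/
section Propagate

/-- `PropagateAt p`: one island (`≥ p` relevant pairwise-exchangeable coordinates) forces, outside a bounded exceptional
set `J`, EVERY relevant coordinate to have `≥ p − 1` exchange partners outside `J` (an archipelago of big islands). -/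
def PropagateAt (p : ℕ) [Fact p.Prime] : Prop :=
  ∃ J₁ : ℕ, ∀ (n : ℕ) (f : (Fin n → Bool) → Bool) (Y : Finset (Fin n)), HasDegF p f (p - 1) → p ≤ Y.card →
    (∀ i ∈ Y, Relevant f i) → Exch f Y →
    ∃ J : Finset (Fin n), J.card ≤ J₁ ∧ ∀ i, i ∉ J → Relevant f i →
      p - 1 ≤ (Finset.univ.filter fun j => j ∉ J ∧ ∀ u : Fin n → Bool, f (u ∘ Equiv.swap i j) = f u).card

/-- ARCHIPELAGO ⟹ NORMAL FORM is the tree's `SubChar.law_of_exchange_partners` (lens-6 g8), so `PropagateAt p → IslandAt p`. -/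
theorem islandAt_of_propagateAt (p : ℕ) [Fact p.Prime] : PropagateAt p → IslandAt p := by
  classical
  rintro ⟨J₁, hJ₁⟩
  refine ⟨J₁, fun n f Y hf hY hrel hex => ?_⟩
  obtain ⟨J, hJ, hbig⟩ := hJ₁ n f Y hf hY hrel hex
  obtain ⟨c, h, hh⟩ := SubChar.law_of_exchange_partners p J f (fun i hi hri => hbig i hi hri) hf
  refine ⟨J, hJ, c, fun u s => h (JLin.proj J u) s, ?_, fun u => hh u⟩
  intro u v huv s
  show h (JLin.proj J u) s = h (JLin.proj J v) s
  congr 1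
  funext i
  unfold JLin.proj
  by_cases hi : i ∈ J
  · rw [if_pos hi, if_pos hi, huv i hi]
  · rw [if_neg hi, if_neg hi]

/-- NORMAL FORM ⟹ ARCHIPELAGO: in `h(u|_J, Σ aᵢuᵢ)` put the members of the SMALL coefficient classes (`< p − 1` members off `J`;
at most `p` classes) into the exceptional set; every remaining coordinate has its whole class (`≥ p − 1` members) as
exchange partners (`exch_of_normalForm`).  Hence `IslandAt p → PropagateAt p` with `J₁ ↦ J₁ + p·p`. -/
theorem propagateAt_of_islandAt (p : ℕ) [hp : Fact p.Prime] : IslandAt p → PropagateAt p := by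
  classical
  rintro ⟨J₁, hJ₁⟩
  refine ⟨J₁ + p * p, fun n f Y hf hY hrel hex => ?_⟩
  obtain ⟨J, hJ, a, h, hdep, hrep⟩ := hJ₁ n f Y hf hY hrel hex
  -- coefficient classes off the junta, and the set of members of small classes
  let B : ZMod p → Finset (Fin n) := fun c => (Finset.univ \ J).filter fun i => a i = c
  let S : Finset (Fin n) := Finset.univ.biUnion fun c => if (B c).card < p - 1 then B c else ∅
  have hBmem : ∀ c i, i ∈ B c ↔ i ∉ J ∧ a i = c := by
    intro c i
    simp [B]
  have hS : S.card ≤ p * p := by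
    calc S.card ≤ ∑ c, (if (B c).card < p - 1 then B c else ∅).card := Finset.card_biUnion_le
      _ ≤ ∑ _c : ZMod p, p := Finset.sum_le_sum fun c _ => by
          by_cases hc : (B c).card < p - 1
          · rw [if_pos hc]; omega
          · rw [if_neg hc, Finset.card_empty]; exact Nat.zero_le _
      _ = p * p := by rw [Finset.sum_const, Finset.card_univ, ZMod.card, smul_eq_mul]
  refine ⟨J ∪ S, ?_, ?_⟩
  · calc (J ∪ S).card ≤ J.card + S.card := Finset.card_union_le _ _
      _ ≤ J₁ + p * p := Nat.add_le_add hJ hS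
  · intro i hi _
    have hiJ : i ∉ J := fun hm => hi (Finset.mem_union_left _ hm)
    have hiS : i ∉ S := fun hm => hi (Finset.mem_union_right _ hm)
    -- the class of `i` is big (else `i ∈ S`)
    have hbig : p - 1 ≤ (B (a i)).card := by
      by_contra hlt
      have hlt' : (B (a i)).card < p - 1 := by omega
      apply hiS
      refine Finset.mem_biUnion.2 ⟨a i, Finset.mem_univ _, ?_⟩
      rw [if_pos hlt']
      exact (hBmem (a i) i).2 ⟨hiJ, rfl⟩
    -- and it consists of exchange partners of `i` outside `J ∪ S`
    refine le_trans hbig (Finset.card_le_card fun j hj => ?_)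
    obtain ⟨hjJ, hja⟩ := (hBmem (a i) j).1 hj
    have hjS : j ∉ S := by
      intro hm
      obtain ⟨c, -, hc⟩ := Finset.mem_biUnion.1 hm
      by_cases hsmall : (B c).card < p - 1
      · rw [if_pos hsmall] at hc
        obtain ⟨-, hjc⟩ := (hBmem c j).1 hc
        have hcc : c = a i := hjc.symm.trans hja
        rw [hcc] at hsmall
        omega
      · rw [if_neg hsmall] at hc
        exact Finset.notMem_empty _ hc
    refine Finset.mem_filter.2 ⟨Finset.mem_univ _, fun hm => ?_, fun u => ?_⟩
    · rcases Finset.mem_union.1 hm with hm | hm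
      · exact hjJ hm
      · exact hjS hm
    · exact exch_of_normalForm hdep hrep hiJ hjJ hja.symm u

/-- **Piece I ⟺ one island propagates to an archipelago** (kernel both ways). -/
theorem islandAt_iff_propagateAt (p : ℕ) [Fact p.Prime] : IslandAt p ↔ PropagateAt p :=
  ⟨propagateAt_of_islandAt p, islandAt_of_propagateAt p⟩

end Propagate

end Summit.QuantumAdvantage.QuantumAdvantage.Theorems.IslandDial
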